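import Summits.CriticalPhenomena.CardyFormulaZ2.Theorems.CardyBoundaryCoulombGasHalfPlaneMarkDensityLawPropGapFunction
import Summits.CriticalPhenomena.CardyFormulaZ2.Theorems.CardyBoundaryCoulombGasHalfPlaneMarkDensityLawPropWired
import Summits.CriticalPhenomena.CardyFormulaZ2.Theorems.CardyBoundaryCoulombGasHalfPlaneMarkDensityLawPropSelfDual
import Summits.CriticalPhenomena.CardyFormulaZ2.Theorems.CardyBoundaryCoulombGasHalfPlaneMarkDensityLawPropShape
import Summits.CriticalPhenomena.CardyFormulaZ2.Theorems.CardyBoundaryCoulombGasHalfPlaneMarkDensityLawDensityIdentification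

/-!
# `HalfPlaneMarkDensityLaw` (crux stmt-CriticalPhenomena-5661), line `Sketch`, cycle 7 (`Proportional`), lead c12-0:
# **THE CRUX IS EXACTLY THE `x`-SHAPE OF THE MARK DENSITY**

For a joint subsequential limit `G` of `P_n(a,b,c,y)` along a strictly increasing `θ` (they exist along a subsequence
of every subsequence, c2-0; the crux's sequence converges along `θ` to `∂₄G`, c4-0):

* `halfPlaneMarkDensityLaw_iff_proportional` — **the crux holds iff, for every `θ, G` and all `a < b < c`,
  `y ↦ G(a,b,c,y)` is PROPORTIONAL to `y ↦ F(η(a,b,c,y))` on `(c,∞)`.**  The factor is then automatically `1`: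
  reflection + translation invariance of `G` make it a continuous function `m(c−b)` of the gap alone
  (`stub_prop_gapFunction`), the wired kernel tends along `θ` to `m(σ)F(x/(x+σ))` (`stub_prop_wired`), and c3-0's
  duality–reflection law on the diagonal forces `m ≡ 1` (`stub_prop_selfDual`) — generalising c6-0's
  `stub_noFreeConstant` from a constant to an arbitrary function of three marks.
* `halfPlaneMarkDensityLaw_iff_shape` — equivalently, **iff `x ↦ ∂₄G(a,b,c,x)·((x−a)(x−b)(x−c))^{2/3}` is constant
  on `(c,∞)`** for every `θ, G, a < b < c` (`stub_shape_prop`: integrate from the closing gap): the entire content of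
  the half-plane mark density law of bond-`ℤ²` — hence of collinear half-plane Cardy C⁺ — is the algebraic `x`-shape
  `((x−a)(x−b)(x−c))^{−2/3}` of the subsequential laws of the rescaled `c`-most joined point; the normalisation
  `cardyConst/3` and the factor `((b−a)(c−b)(c−a))^{1/3}` carry no information beyond the lattice symmetries.
-/

noncomputable section

namespace Summit.CriticalPhenomena.CardyFormulaZ2.Cruxes.HalfPlaneMarkDensityLaw.SketchLine

open Literature.Probability.Percolation Literature.Probability.LatticeModels
open Literature.Probability.RandomPlanarGeometry (crossRatio cardyConst cardyConst_pos)
open MeasureTheory Filter Set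
open scoped Topology
open Summit.CriticalPhenomena.CardyFormulaZ2.Theses.CardyBoundaryCoulombGas (HalfPlaneMarkDensityLaw)
open Summit.CriticalPhenomena.CardyFormulaZ2.Theorems.HalfPlaneMarkDensityLaw.Negative

namespace Proportional

/-- **The crux ⟺ proportionality to Cardy in the fourth mark.** [folklore] -/
theorem halfPlaneMarkDensityLaw_iff_proportional :
    HalfPlaneMarkDensityLaw ↔
    ∀ θ : ℕ → ℕ, StrictMono θ → ∀ G : ℝ → ℝ → ℝ → ℝ → ℝ,
      (∀ a b c y : ℝ, a < b → b < c → c < y →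
        Tendsto (fun n ↦ μ.real (openCrossing halfPlane (arcA a b (θ n))
          (rowIcc ⌊c * (θ n : ℕ)⌋ ⌊y * (θ n : ℕ)⌋))) atTop (𝓝 (G a b c y))) →
      ∀ a b c : ℝ, a < b → b < c → ∃ m : ℝ, ∀ y : ℝ, c < y →
        G a b c y = m * Literature.Probability.RandomPlanarGeometry.cardyFunction (crossRatio ![a, b, c, y]) := by
  constructor
  · intro h θ hθ G hG a b c hab hbc
    refine ⟨1, fun y hcy ↦ ?_⟩
    rw [one_mul]
    exact (Subseq.halfPlaneMarkDensityLaw_iff_jointLimits.1 h) θ hθ G hG a b c y hab hbc hcy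
  · intro h
    refine Subseq.halfPlaneMarkDensityLaw_iff_jointLimits.2 fun θ hθ G hG a b c y hab hbc hcy ↦ ?_
    obtain ⟨mfun, hcont, hm⟩ := stub_prop_gapFunction hG hθ (h θ hθ G hG)
    have hw := stub_prop_wired hG hθ mfun hcont hm
    have h1 : mfun (c - b) = 1 := stub_prop_selfDual hθ mfun hw (c - b) (by linarith)
    rw [hm a b c y hab hbc hcy, h1, one_mul]

/-- Under the identification `G = F∘η` on `(c,∞)`, the fourth-mark derivative of `G` is Cardy's density. [folklore] -/
theorem deriv_eq_density_of_eq {G : ℝ → ℝ → ℝ → ℝ → ℝ} {a b c x : ℝ} (hab : a < b) (hbc : b < c) (hcx : c < x)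
    (h : ∀ y : ℝ, c < y → G a b c y = Literature.Probability.RandomPlanarGeometry.cardyFunction (crossRatio ![a, b, c, y])) :
    deriv (G a b c) x = density a b c x := by
  have hev : G a b c =ᶠ[𝓝 x] fun y ↦ Literature.Probability.RandomPlanarGeometry.cardyFunction (crossRatio ![a, b, c, y]) := by
    filter_upwards [Ioi_mem_nhds hcx] with y hy
    exact h y hy
  rw [hev.deriv_eq]
  exact (hasDerivAt_cardy_crossRatio hab hbc hcx).deriv

/-- **The crux ⟺ the `x`-shape of the density**: `HalfPlaneMarkDensityLaw` holds iff for every joint subsequential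
limit `G` and all `a < b < c`, `x ↦ ∂₄G(a,b,c,x)·((x−a)(x−b)(x−c))^{2/3}` is constant on `(c,∞)`. [folklore] -/
theorem halfPlaneMarkDensityLaw_iff_shape :
    HalfPlaneMarkDensityLaw ↔
    ∀ θ : ℕ → ℕ, StrictMono θ → ∀ G : ℝ → ℝ → ℝ → ℝ → ℝ,
      (∀ a b c y : ℝ, a < b → b < c → c < y →
        Tendsto (fun n ↦ μ.real (openCrossing halfPlane (arcA a b (θ n))
          (rowIcc ⌊c * (θ n : ℕ)⌋ ⌊y * (θ n : ℕ)⌋))) atTop (𝓝 (G a b c y))) →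
      ∀ a b c : ℝ, a < b → b < c → ∃ K : ℝ, ∀ x : ℝ, c < x →
        deriv (G a b c) x * ((x - a) * (x - b) * (x - c)) ^ ((2 : ℝ) / 3) = K := by
  constructor
  · intro h θ hθ G hG a b c hab hbc
    have hid := (Subseq.halfPlaneMarkDensityLaw_iff_jointLimits.1 h) θ hθ G hG
    refine ⟨cardyConst / 3 * ((b - a) * (c - b) * (c - a)) ^ (1 / 3 : ℝ), fun x hcx ↦ ?_⟩
    rw [deriv_eq_density_of_eq hab hbc hcx fun y hy ↦ hid a b c y hab hbc hy]
    have hP : 0 < (x - a) * (x - b) * (x - c) := by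
      have h1 : 0 < x - a := by linarith
      have h2 : 0 < x - b := by linarith
      have h3 : 0 < x - c := by linarith
      positivity
    simp only [density]
    rw [mul_assoc, ← Real.rpow_add hP]
    norm_num
  · intro h
    exact halfPlaneMarkDensityLaw_iff_proportional.2 fun θ hθ G hG ↦ stub_shape_prop hG hθ (h θ hθ G hG)

end Proportional

end Summit.CriticalPhenomena.CardyFormulaZ2.Cruxes.HalfPlaneMarkDensityLaw.SketchLine
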